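import Mathlib
import Literature.Analysis.FluidPDE.VectorCalculus
import Summits.NavierStokesRegularity.NavierStokesRegularity.Theorems.FilamentSkeletonRssMatchedKernelDivFreeTrace
import Summits.NavierStokesRegularity.NavierStokesRegularity.Theorems.FilamentSkeletonRssSelectionBoxRJRungSlipLaw

/-!
# `SkeletonJ1G` (stmt-NavierStokesRegularity-27849) · stub `stub_normalBlock` — the TRACE HALF of clause 12
# for the MATCHED kernel: `⟪A m, m⟫ + ⟪A n, n⟫ < 0` at every stagnation point, in the crux's own vocabulary

First instalment of the matched-kernel port of `SelectionBoxRJRung.clause12_of_skeleton` (p599125, `+1` kernel) toward the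
registered stub `stub_normalBlock : NormalBlockMatched` of line `near_straight_newton` (skeleton of record
54b14921a1db6b91).  With `u`, `v` given by the DEFINING FORMULAS of `SkeletonJ1G` / `FlatJ1G` (matched kernel
`((‖y − Z k σ‖² + e^{−(1+γ_E−log 2)}·Aa k σ)^{3/2})⁻¹`), a skeleton datum satisfying — verbatim — clause 2 (`C²` unit-speed
filaments, `w` differentiable), clause 5 (linear escape), clause 7 (tangency on the ball `‖X‖ ≤ Rb√(Γ log Γ)`), clause 8
(waist `‖X(c)‖ ≤ Rw√Γ`), of clause 11 only `w(c) = 0` and `3/2 + δ ≤ w′(c)`, core areas DIFFERENTIABLE with a FLOOR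
`Λ⁻¹ ≤ Aa` (the near-straight regime `NearStraightJ1G`; the reason for the reshape proposal 888398bc7a8b5bf0), and
`Γ ≥ exp((Rw/Rb)² + 1)` (so that the waist sits inside the tangency ball): for EVERY filament `j` and EVERY orthonormal
completion `(m, n)` of the tangent `X_j′(c_j)`,

  `⟪A m, m⟫ + ⟪A n, n⟫ < 0`,  `A = Dv(X_j(c_j))`           (`matched_normalBlock_trace_neg`).

WHY: `Dv` has basis-trace `3/2` (`MatchedKernel.matchedSkeletonField_trace_eq`: the matched-core Biot–Savart fields are
divergence-free, the frame part `½ id − α e₃×` has trace `3/2`), and the tangent is an exact eigenvector with eigenvalue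
`w′(c) ≥ 3/2 + δ` (kernel-free `SelectionBoxRJRung.box_eigenvector_law`), so the normal block has trace `3/2 − w′(c) < 0`
(`SelectionBoxRJRung.normalBlock_trace_neg`).  The DETERMINANT half (rotation dominance of the own matched core,
`RungNormalBlock{Tools,Self,Det}` with `1 ↦ μ(σ)² ∈ [κ/Λ, 5κ·KA]`) is the remaining instalment.

Lane ns-filament-19175-p1 g11; `--supports stmt-NavierStokesRegularity-27849`.  HONEST FRAMING: bookkeeping about a
HYPOTHETICAL filament skeleton on the NEGATIVE side of a MODEL route; nothing here bears on Navier–Stokes regularity or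
blow-up; neither the stub nor the crux is proved by this file.
-/

set_option linter.dupNamespace false

noncomputable section

namespace Summit.NavierStokesRegularity.NavierStokesRegularity.Theorems.SkeletonJ1GNormalBlock

open Set Function Filter MeasureTheory Real
open Literature.Analysis.FluidPDE
open Summit.NavierStokesRegularity.NavierStokesRegularity.Theorems.SelectionBoxRJRung
open Summit.NavierStokesRegularity.NavierStokesRegularity.Theorems.MatchedKernel
open scoped InnerProductSpace Topology

/-- **Trace half of clause 12, matched kernel.**  See the module docstring: for a skeleton datum satisfying clauses
2, 5, 7, 8 and `w_j(c_j) = 0`, `3/2 + δ ≤ w_j′(c_j)` of `SkeletonJ1G` (with `u`, `v` given by their defining formulas,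
matched kernel), core areas differentiable with the floor `Λ⁻¹ ≤ Aa`, and `Γ ≥ exp((Rw/Rb)² + 1)`: every filament `j` and
every orthonormal completion `(m, n)` of `X_j′(c_j)` satisfy `⟪A m, m⟫ + ⟪A n, n⟫ < 0`, `A = Dv(X_j(c_j))`. [folklore] -/
theorem matched_normalBlock_trace_neg {N : ℕ} {Γ δ Λ Rw Rb cg : ℝ} (hδ : 0 < δ) (hΛ : 0 < Λ) (hRw : 0 < Rw)
    (hRb : 0 < Rb) (hcg : 0 < cg) (hΓ1 : Real.exp ((Rw / Rb) ^ 2 + 1) ≤ Γ)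
    {γ : Fin N → ℝ} {α : ℝ} {X : Fin N → ℝ → EuclideanSpace ℝ (Fin 3)} {w : Fin N → ℝ → ℝ} {c : Fin N → ℝ}
    {Aa : Fin N → ℝ → ℝ}
    {u : (Fin N → ℝ → EuclideanSpace ℝ (Fin 3)) → EuclideanSpace ℝ (Fin 3) → EuclideanSpace ℝ (Fin 3)}
    {v : EuclideanSpace ℝ (Fin 3) → EuclideanSpace ℝ (Fin 3)}
    (hu : ∀ Z y, u Z y = ∑ k, (Γ * γ k / (4 * Real.pi)) • ∫ σ : ℝ,
      ((‖y - Z k σ‖ ^ 2 + Real.exp (-(1 + Real.eulerMascheroniConstant - Real.log 2)) * Aa k σ) ^ (3 / 2 : ℝ))⁻¹ •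
        cross (deriv (Z k) σ) (y - Z k σ))
    (hv : ∀ y, v y = u X y + (1 / 2 : ℝ) • y - α • cross (EuclideanSpace.single 2 1) y)
    (hreg : ∀ j, ContDiff ℝ 2 (X j) ∧ Differentiable ℝ (w j) ∧ (∀ τ, ‖deriv (X j) τ‖ = 1))
    (hesc : ∀ j τ, cg * |τ - c j| ≤ Rw * Real.sqrt Γ + ‖X j τ‖)
    (htan : ∀ j τ, ‖X j τ‖ ≤ Rb * Real.sqrt (Γ * Real.log Γ) → v (X j τ) = w j τ • deriv (X j) τ)
    (hwaist : ∀ j, ‖X j (c j)‖ ≤ Rw * Real.sqrt Γ)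
    (hstag : ∀ j, w j (c j) = 0 ∧ 3 / 2 + δ ≤ deriv (w j) (c j))
    (hA : ∀ j, Differentiable ℝ (Aa j) ∧ ∀ τ, Λ⁻¹ ≤ Aa j τ)
    (j : Fin N) {m n : EuclideanSpace ℝ (Fin 3)} (hon : Orthonormal ℝ ![deriv (X j) (c j), m, n]) :
    ⟪fderiv ℝ v (X j (c j)) m, m⟫_ℝ + ⟪fderiv ℝ v (X j (c j)) n, n⟫_ℝ < 0 := by
  have hΓ0 : 1 ≤ Γ := le_trans (Real.one_le_exp (by positivity)) hΓ1
  have hΓ : 0 < Γ := by linarith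
  have hG : 0 < Real.sqrt Γ := Real.sqrt_pos.2 hΓ
  -- the matched core profiles and their common floor
  set κ : ℝ := Real.exp (-(1 + Real.eulerMascheroniConstant - Real.log 2)) with hκ
  have hκ0 : 0 < κ := Real.exp_pos _
  have hm₀ : 0 < κ * Λ⁻¹ := mul_pos hκ0 (inv_pos.2 hΛ)
  have hm : ∀ k σ, κ * Λ⁻¹ ≤ (fun k σ => κ * Aa k σ) k σ := fun k σ => by
    dsimp only; exact mul_le_mul_of_nonneg_left ((hA k).2 σ) hκ0.le
  have hmc : ∀ k, Continuous ((fun k σ => κ * Aa k σ) k) := fun k => by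
    dsimp only; exact continuous_const.mul (hA k).1.continuous
  -- the frame velocity as an explicit function
  obtain ⟨coef, hcoef⟩ : ∃ coef : Fin N → ℝ, coef = fun k => Γ * γ k / (4 * Real.pi) := ⟨_, rfl⟩
  have hvfun : v = fun y : EuclideanSpace ℝ (Fin 3) =>
      (∑ k, coef k • ∫ σ : ℝ, ((‖y - X k σ‖ ^ 2 + (fun k σ => κ * Aa k σ) k σ) ^ (3 / 2 : ℝ))⁻¹ •
          cross (deriv (X k) σ) (y - X k σ))
        + (1 / 2 : ℝ) • y - α • cross (EuclideanSpace.single 2 1) y := by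
    funext y; rw [hv y, hu X y, hcoef]
  -- hypotheses of the matched Biot–Savart toolkit for every filament
  have hX1 : ∀ k, ContDiff ℝ 1 (X k) := fun k => (hreg k).1.of_le (by norm_num)
  have hdX : ∀ k τ, ‖deriv (X k) τ‖ ≤ 1 := fun k τ => ((hreg k).2.2 τ).le
  have hgrow : ∀ k τ, cg * |τ| - (cg * |c k| + Rw * Real.sqrt Γ) ≤ ‖X k τ‖ := by
    intro k τ
    have h1 := hesc k τ
    have h2 : |τ| - |c k| ≤ |τ - c k| := abs_sub_abs_le_abs_sub τ (c k)
    nlinarith [hcg]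
  -- trace `3/2` and differentiability of `v` at the stagnation point
  have htr : ∀ {ι : Type} [Fintype ι] (b : OrthonormalBasis ι ℝ (EuclideanSpace ℝ (Fin 3))),
      ∑ i, ⟪b i, fderiv ℝ v (X j (c j)) (b i)⟫_ℝ = 3 / 2 := by
    intro ι _ b
    have h := matchedSkeletonField_trace_eq (m := fun k σ => κ * Aa k σ) (coef := coef) (α := α)
      hm₀ hm hmc hcg hX1 hdX hgrow b (X j (c j))
    rw [hvfun]; exact h
  have hdiffv : DifferentiableAt ℝ v (X j (c j)) := by
    rw [hvfun]
    exact matchedSkeletonField_differentiableAt (m := fun k σ => κ * Aa k σ) (coef := coef) (α := α)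
      hm₀ hm hmc hcg hX1 hdX hgrow (X j (c j))
  -- tangency holds on a neighbourhood of the stagnation point (waist inside the ball)
  obtain ⟨hXj, hwj, hunit⟩ := hreg j
  have hball : ∀ᶠ τ in 𝓝 (c j), v (X j τ) = w j τ • deriv (X j) τ := by
    have hlog : (Rw / Rb) ^ 2 < Real.log Γ := by
      have h := (Real.le_log_iff_exp_le hΓ).2 hΓ1
      linarith
    have hlt : Rw * Real.sqrt Γ < Rb * Real.sqrt (Γ * Real.log Γ) := by
      have h1 : Rw / Rb < Real.sqrt (Real.log Γ) := (Real.lt_sqrt (by positivity)).2 hlog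
      have h2 : Rw < Rb * Real.sqrt (Real.log Γ) := by rwa [div_lt_iff₀' hRb] at h1
      calc Rw * Real.sqrt Γ < (Rb * Real.sqrt (Real.log Γ)) * Real.sqrt Γ := mul_lt_mul_of_pos_right h2 hG
        _ = Rb * Real.sqrt (Γ * Real.log Γ) := by rw [Real.sqrt_mul hΓ.le]; ring
    have hopen : IsOpen {τ : ℝ | ‖X j τ‖ < Rb * Real.sqrt (Γ * Real.log Γ)} :=
      isOpen_lt (hXj.continuous.norm) continuous_const
    have hmem : c j ∈ {τ : ℝ | ‖X j τ‖ < Rb * Real.sqrt (Γ * Real.log Γ)} := lt_of_le_of_lt (hwaist j) hlt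
    exact Filter.eventually_of_mem (hopen.mem_nhds hmem) fun τ hτ => htan j τ (le_of_lt hτ)
  -- eigenvector law and the trace inequality
  have hAt : fderiv ℝ v (X j (c j)) (deriv (X j) (c j)) = deriv (w j) (c j) • deriv (X j) (c j) :=
    box_eigenvector_law hXj hwj (hstag j).1 hdiffv hball
  exact normalBlock_trace_neg (fderiv ℝ v (X j (c j))) hon hAt htr hδ (hstag j).2

end Summit.NavierStokesRegularity.NavierStokesRegularity.Theorems.SkeletonJ1GNormalBlock
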